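import Literature.NumberTheory.Automorphic.ArchEndoscopicCartanAtlas   -- ★ p849525 (T-ATLAS) PART 1: `endoTorus`, `endoBlock`, `endoCircle`, place components and their matrices
import Literature.NumberTheory.Automorphic.ArchDiagonalTorus           -- ★ `archWeylDiscr_diagonal` (via `ArchWeylDiscriminant`), `mixedSpace_ext`
import HarnessLib

/-!
# `G`-regularity on the Cartan atlas of `H_∞` in coordinates ((T-ATLAS) PART 1b; Rogawski 1990 §3.1, §4.3; Shelstad 1979 §4)

Topic `NumberTheory/Automorphic`; namespace `Literature.NumberTheory.Automorphic.UnitaryGroup`.  THEOREMS ONLY (no `def`, no instance, no notation, no axiom, no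
named fact, no `sorry`).  Cell `pub/hodgecm-mathlib`, crux H413 (`stmt-HodgeConjecture-24833`), F0∕P3c line LH3, DIRECT ROAD of `stub_N9`; seat LH3-p03 (g2), organ (T-ATLAS)
of LH3-plan (g2) DEALER WORDS #6 (g2) — the regularity head the coordinate-level regular sets `RegS S` of (COORD) (LH3-p01 (g3)) dock into.  Count-neutral.

THE MATHEMATICS.  For the chart `endoTorus S c ∈ H_∞` (★ PART 1: split `2`-block `diag(e^{x_w+iθ_w}, e^{−x_w+iθ_w})` at `w ∈ S`, Cayley circle block
`P·diag(e^{ic_w0}, e^{ic_w2})·P⁻¹` at `w ∉ S`, circle entry `e^{ic_w1}`), the image `ι_∞(endoTorus S c) ∈ GL₃(L ⊗ ℝ)` has, at every complex place `w`, the SAME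
characteristic polynomial as `diag(λ_w)` with `λ_w = (e^{x_w+iθ_w}, e^{ic_w1}, e^{−x_w+iθ_w})` (`w ∈ S`) resp. `(e^{ic_w0}, e^{ic_w1}, e^{ic_w2})` (`w ∉ S`) (★ `map_endoGL`,
★ `charpoly_endoGL`, `Matrix.charpoly_units_conj`); hence (coefficients place by place, ★ `mixedSpace_ext`) `charpoly ι_∞(endoTorus S c) = charpoly diag(d)` over `L ⊗ ℝ`
with `d_i = (λ_{w,i})_w`, so `|D|_∞` agrees with that of `diag(d)` = `∏_w ∏_{i≠j} |λ_{w,i} − λ_{w,j}|` (★ `archWeylDiscr_diagonal`) and (★ `archWeylDiscr_ne_zero_iff`)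
**`endoTorus S c` is `G`-REGULAR iff at every place the three eigenvalues are pairwise distinct** iff `e^{ic_w0}, e^{ic_w1}, e^{ic_w2}` are pairwise distinct at `w ∉ S`
and `x_w = c w 0 ≠ 0` at `w ∈ S` (then `|e^{±x_w}| ≠ 1 = |e^{ic_w1}|` and `e^{x_w} ≠ e^{−x_w}`).
* `charpoly_map_evalC_endoEmbArch_endoTorus` — the place-`w` characteristic polynomial of `ι_∞(endoTorus S c)`;
* `isArchGRegular_endoTorus_iff_forall_injective` — `G`-regular iff the eigenvalue triple is injective at every place;
* **`isArchGRegular_endoTorus_iff`** — in coordinates: `(∀ w ∉ S, Injective ![e^{ic_w0}, e^{ic_w1}, e^{ic_w2}]) ∧ (∀ w ∈ S, c w 0 ≠ 0)`.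
HONEST LABEL: HC_CM is proved only modulo the 7 printed citations (2 remaining: hLiu418 = `stmt-HodgeConjecture-24832`, h413 = `stmt-HodgeConjecture-24833`) until rung 0
closes; count-neutral bookkeeping on the chart file.

## References
* [Rogawski1990] J. D. Rogawski, *Automorphic Representations of Unitary Groups in Three Variables*, Ann. of Math. Stud. 123 (1990), §3.1 p. 19 (regular elements),
  §4.3 p. 42 (`G`-regular elements of `H`), §8.2 p. 122, §14.3 p. 234.
* [Shelstad1979] D. Shelstad, *Characters and inner forms of a quasi-split group over ℝ*, Compositio Math. 39 (1979), §4 p. 22 (`T_reg`).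
-/

set_option autoImplicit false

noncomputable section

open NumberField NumberField.InfinitePlace NumberField.mixedEmbedding Matrix Complex Polynomial
open scoped MatrixGroups Matrix ComplexConjugate Real Classical

namespace Literature.NumberTheory.Automorphic.UnitaryGroup

open Literature.NumberTheory.Rogawski1990

section Regular

variable (L : Type) [Field L] [NumberField L] [IsCMField L]

/-- `![a, b, c]` is injective when its entries are pairwise distinct. [folklore] -/
private theorem injective_vec3 {a b d : ℂ} (hab : a ≠ b) (had : a ≠ d) (hbd : b ≠ d) : Function.Injective (![a, b, d] : Fin 3 → ℂ) := by
  intro i j h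
  fin_cases i <;> fin_cases j
  all_goals first
    | rfl
    | (exfalso; simp at h; first | exact hab h | exact had h | exact hbd h | exact hab h.symm | exact had h.symm | exact hbd h.symm)

/-- **`|D|_∞` of a diagonal matrix over `L ⊗ ℝ` (CM `L`) is non-zero iff the diagonal entries are pairwise distinct at every complex place** (★ `archWeylDiscr_diagonal`;
every infinite place of a CM field is complex). [cite: Rogawski1990, §3.1 p. 19] -/
theorem archWeylDiscr_diagonal_ne_zero_iff {N : ℕ} (d : Fin N → mixedSpace L) :
    archWeylDiscr (Matrix.diagonal d) ≠ 0 ↔ ∀ w : {w : InfinitePlace L // IsComplex w}, Function.Injective fun i => (d i).2 w := by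
  rw [archWeylDiscr_diagonal]
  have hall : ∀ w : InfinitePlace L, IsComplex w := IsTotallyComplex.isComplex
  constructor
  · intro h w i j hij
    by_contra hne
    have h1 := (Finset.prod_ne_zero_iff.1 h) w.1 (Finset.mem_univ _)
    have h2 := (Finset.prod_ne_zero_iff.1 h1) i (Finset.mem_univ _)
    have h3 := (Finset.prod_ne_zero_iff.1 h2) j (Finset.mem_erase.2 ⟨Ne.symm hne, Finset.mem_univ _⟩)
    apply h3
    rw [normAtPlace_apply_of_isComplex w.2, Prod.snd_sub, Pi.sub_apply]
    have hij' : (d i).2 w = (d j).2 w := hij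
    rw [show (⟨w.1, w.2⟩ : {w : InfinitePlace L // IsComplex w}) = w from rfl, hij', sub_self, norm_zero]
  · intro h
    refine Finset.prod_ne_zero_iff.2 fun w _ => Finset.prod_ne_zero_iff.2 fun i _ => Finset.prod_ne_zero_iff.2 fun j hj => ?_
    rw [normAtPlace_apply_of_isComplex (hall w), norm_ne_zero_iff, Prod.snd_sub, Pi.sub_apply, sub_ne_zero]
    exact fun heq => (Finset.mem_erase.1 hj).1 ((h ⟨w, hall w⟩ heq).symm)

variable (S : Finset {w : InfinitePlace L // IsComplex w}) (c : {w : InfinitePlace L // IsComplex w} → Fin 3 → ℝ)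

/-- **THE PLACE-`w` CHARACTERISTIC POLYNOMIAL OF `ι_∞(endoTorus S c)`** is `∏_i (X − λ_{w,i})` for the eigenvalue triple `λ_w = (e^{x_w+iθ_w}, e^{ic_w1}, e^{−x_w+iθ_w})`
at a split place, `(e^{ic_w0}, e^{ic_w1}, e^{ic_w2})` at a compact one (★ `map_endoGL`, ★ `charpoly_endoGL`, `Matrix.charpoly_units_conj`). [cite: Rogawski1990, §4.3 p. 42; §8.2 p. 122] -/
theorem charpoly_map_evalC_endoEmbArch_endoTorus (w : {w : InfinitePlace L // IsComplex w}) :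
    ((((endoEmbArch L (endoTorus L S c)).val : GL (Fin 3) (mixedSpace L)) : Matrix (Fin 3) (Fin 3) (mixedSpace L)).map (evalC L w)).charpoly =
      ∏ i : Fin 3, (X - Polynomial.C ((if w ∈ S then
        (![Complex.exp ((c w 0 : ℂ) + (c w 2 : ℂ) * I), (Circle.exp (c w 1) : ℂ), Complex.exp (-(c w 0 : ℂ) + (c w 2 : ℂ) * I)] : Fin 3 → ℂ)
        else (![(Circle.exp (c w 0) : ℂ), (Circle.exp (c w 1) : ℂ), (Circle.exp (c w 2) : ℂ)] : Fin 3 → ℂ)) i)) := by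
  -- the place component of `ι_∞(γ)` is `endoGL` of the place components
  have hmap : (((endoEmbArch L (endoTorus L S c)).val : GL (Fin 3) (mixedSpace L)) : Matrix (Fin 3) (Fin 3) (mixedSpace L)).map (evalC L w) =
      ((endoGL ((endoBlock L S c w : GL (Fin 2) ℂ), (endoCircle L c w : GL (Fin 1) ℂ)) : GL (Fin 3) ℂ) : Matrix (Fin 3) (Fin 3) ℂ) := by
    have h1 : (Matrix.GeneralLinearGroup.map (evalC L w) ((endoEmbArch L (endoTorus L S c)).val : GL (Fin 3) (mixedSpace L)) : Matrix (Fin 3) (Fin 3) ℂ) =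
        (((endoEmbArch L (endoTorus L S c)).val : GL (Fin 3) (mixedSpace L)) : Matrix (Fin 3) (Fin 3) (mixedSpace L)).map (evalC L w) := rfl
    rw [← h1, coe_endoEmbArch, map_endoGL, ← coe_archPiEquivCM_apply, ← coe_archPiEquivCM_apply, archPiEquivCM_endoTorus_fst, archPiEquivCM_endoTorus_snd]
  rw [hmap, charpoly_endoGL]
  -- the `2`-block has the characteristic polynomial of a diagonal matrix in both cases
  have hb : (((endoBlock L S c w : GL (Fin 2) ℂ)) : Matrix (Fin 2) (Fin 2) ℂ).charpoly =
      (Matrix.diagonal (if w ∈ S then ![Complex.exp ((c w 0 : ℂ) + (c w 2 : ℂ) * I), Complex.exp (-(c w 0 : ℂ) + (c w 2 : ℂ) * I)]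
        else ![(Circle.exp (c w 0) : ℂ), (Circle.exp (c w 2) : ℂ)])).charpoly := by
    by_cases hw : w ∈ S
    · rw [if_pos hw, coe_endoBlock_of_mem L c hw]
      congr 1
      ext i j; fin_cases i <;> fin_cases j <;> simp
    · rw [if_neg hw]
      have hval : ((endoBlock L S c w : GL (Fin 2) ℂ) : Matrix (Fin 2) (Fin 2) ℂ) =
          (Matrix.GeneralLinearGroup.mkOfDetNeZero !![(1 : ℂ), 1; 1, -1] det_cayleyTwo_ne_zero).val *
            (circleDiagonal 2 ![Circle.exp (c w 0), Circle.exp (c w 2)] : GL (Fin 2) ℂ).val *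
            (Matrix.GeneralLinearGroup.mkOfDetNeZero !![(1 : ℂ), 1; 1, -1] det_cayleyTwo_ne_zero).val⁻¹ := by
        unfold endoBlock
        rw [if_neg hw]
        rw [← Matrix.coe_units_inv, ← Units.val_mul, ← Units.val_mul]
      rw [hval, Matrix.charpoly_units_conj, coe_circleDiagonal]
      congr 1
      ext i j; fin_cases i <;> fin_cases j <;> simp
  rw [hb, coe_endoCircle, Matrix.charpoly_diagonal, Matrix.charpoly_diagonal]
  by_cases hw : w ∈ S
  · simp only [if_pos hw, Fin.prod_univ_three, Fin.prod_univ_two, Fin.prod_univ_one]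
    simp
    ring
  · simp only [if_neg hw, Fin.prod_univ_three, Fin.prod_univ_two, Fin.prod_univ_one]
    simp
    ring

/-- **`endoTorus S c` is `G`-regular iff its eigenvalue triple is injective at every complex place.**  (`charpoly ι_∞(endoTorus S c) = charpoly diag(d)` over `L ⊗ ℝ`
coefficientwise from the places, ★ `mixedSpace_ext`; then ★ `archWeylDiscr_ne_zero_iff` + `archWeylDiscr_diagonal_ne_zero_iff`.) [cite: Rogawski1990, §3.1 p. 19; §4.3 p. 42] -/
theorem isArchGRegular_endoTorus_iff_forall_injective :
    IsArchGRegular L (endoTorus L S c) ↔ ∀ w : {w : InfinitePlace L // IsComplex w}, Function.Injective (if w ∈ S then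
        (![Complex.exp ((c w 0 : ℂ) + (c w 2 : ℂ) * I), (Circle.exp (c w 1) : ℂ), Complex.exp (-(c w 0 : ℂ) + (c w 2 : ℂ) * I)] : Fin 3 → ℂ)
        else (![(Circle.exp (c w 0) : ℂ), (Circle.exp (c w 1) : ℂ), (Circle.exp (c w 2) : ℂ)] : Fin 3 → ℂ)) := by
  -- the comparison diagonal over `L ⊗ ℝ`
  set d : Fin 3 → mixedSpace L := fun i => ((0 : {w : InfinitePlace L // IsReal w} → ℝ), fun w => (if w ∈ S then
        (![Complex.exp ((c w 0 : ℂ) + (c w 2 : ℂ) * I), (Circle.exp (c w 1) : ℂ), Complex.exp (-(c w 0 : ℂ) + (c w 2 : ℂ) * I)] : Fin 3 → ℂ)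
        else (![(Circle.exp (c w 0) : ℂ), (Circle.exp (c w 1) : ℂ), (Circle.exp (c w 2) : ℂ)] : Fin 3 → ℂ)) i) with hd
  -- characteristic polynomials agree over `L ⊗ ℝ` (coefficients, place by place)
  have hchar : ((((endoEmbArch L (endoTorus L S c)).val : GL (Fin 3) (mixedSpace L)) : Matrix (Fin 3) (Fin 3) (mixedSpace L))).charpoly =
      (Matrix.diagonal d).charpoly := by
    apply Polynomial.ext
    intro n
    refine mixedSpace_ext (↥(maximalRealSubfield L)) L (IsCMField.complexConj L) (IsCMField.complexConj_ne_one L) (complexConj_smul_infinitePlace L) fun w => ?_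
    have h1 : (evalC L w) (((((endoEmbArch L (endoTorus L S c)).val : GL (Fin 3) (mixedSpace L)) : Matrix (Fin 3) (Fin 3) (mixedSpace L))).charpoly.coeff n) =
        (∏ i : Fin 3, (X - Polynomial.C ((if w ∈ S then
          (![Complex.exp ((c w 0 : ℂ) + (c w 2 : ℂ) * I), (Circle.exp (c w 1) : ℂ), Complex.exp (-(c w 0 : ℂ) + (c w 2 : ℂ) * I)] : Fin 3 → ℂ)
          else (![(Circle.exp (c w 0) : ℂ), (Circle.exp (c w 1) : ℂ), (Circle.exp (c w 2) : ℂ)] : Fin 3 → ℂ)) i))).coeff n := by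
      rw [← Polynomial.coeff_map, ← Matrix.charpoly_map, charpoly_map_evalC_endoEmbArch_endoTorus]
    have h2 : (evalC L w) ((Matrix.diagonal d).charpoly.coeff n) =
        (∏ i : Fin 3, (X - Polynomial.C ((if w ∈ S then
          (![Complex.exp ((c w 0 : ℂ) + (c w 2 : ℂ) * I), (Circle.exp (c w 1) : ℂ), Complex.exp (-(c w 0 : ℂ) + (c w 2 : ℂ) * I)] : Fin 3 → ℂ)
          else (![(Circle.exp (c w 0) : ℂ), (Circle.exp (c w 1) : ℂ), (Circle.exp (c w 2) : ℂ)] : Fin 3 → ℂ)) i))).coeff n := by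
      rw [← Polynomial.coeff_map, ← Matrix.charpoly_map, Matrix.diagonal_map (map_zero _), Matrix.charpoly_diagonal]
      rfl
    exact h1.trans h2.symm
  -- `|D|_∞` through the diagonal
  have hD : IsArchGRegular L (endoTorus L S c) ↔ archWeylDiscr (Matrix.diagonal d) ≠ 0 := by
    show IsRegularElt ((endoEmbArch L (endoTorus L S c)).val : GL (Fin 3) (mixedSpace L)) ↔ _
    rw [← archWeylDiscr_ne_zero_iff, archWeylDiscr_def, archWeylDiscr_def]
    simp only [Matrix.discr]
    rw [hchar]
  rw [hD, archWeylDiscr_diagonal_ne_zero_iff]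

/-- **`G`-REGULARITY OF THE CHART IN COORDINATES**: `endoTorus S c` is `G`-regular iff at every COMPACT place the three unit eigenvalues `e^{ic_w0}, e^{ic_w1}, e^{ic_w2}`
are pairwise distinct and at every SPLIT place `x_w = c w 0 ≠ 0` (then `|e^{±x_w}| ≠ 1 = |e^{ic_w1}|` and `e^{x_w} ≠ e^{−x_w}` make the triple injective; conversely
`x_w = 0` gives the double eigenvalue `e^{iθ_w}`) — the `G`-regular form of (COORD)'s `RegS S`. [cite: Rogawski1990, §4.3 p. 42; §3.1 p. 19] [cite: Shelstad1979, §4 p. 22] -/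
theorem isArchGRegular_endoTorus_iff :
    IsArchGRegular L (endoTorus L S c) ↔
      (∀ w, w ∉ S → Function.Injective (![(Circle.exp (c w 0) : ℂ), (Circle.exp (c w 1) : ℂ), (Circle.exp (c w 2) : ℂ)] : Fin 3 → ℂ)) ∧
        (∀ w, w ∈ S → c w 0 ≠ 0) := by
  rw [isArchGRegular_endoTorus_iff_forall_injective]
  constructor
  · intro h
    refine ⟨fun w hw => ?_, fun w hw h0 => ?_⟩
    · have h' := h w
      rw [if_neg hw] at h'
      exact h'
    · have hi := h w
      rw [if_pos hw] at hi
      have heq : (![Complex.exp ((c w 0 : ℂ) + (c w 2 : ℂ) * I), (Circle.exp (c w 1) : ℂ), Complex.exp (-(c w 0 : ℂ) + (c w 2 : ℂ) * I)] : Fin 3 → ℂ) 0 =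
          (![Complex.exp ((c w 0 : ℂ) + (c w 2 : ℂ) * I), (Circle.exp (c w 1) : ℂ), Complex.exp (-(c w 0 : ℂ) + (c w 2 : ℂ) * I)] : Fin 3 → ℂ) 2 := by
        simp [h0]
      exact absurd (hi heq) (by decide)
  · rintro ⟨hc, hs⟩ w
    by_cases hw : w ∈ S
    · rw [if_pos hw]
      have hx : c w 0 ≠ 0 := hs w hw
      have n0 : ‖Complex.exp ((c w 0 : ℂ) + (c w 2 : ℂ) * I)‖ = Real.exp (c w 0) := by
        rw [Complex.norm_exp]; simp
      have n2 : ‖Complex.exp (-(c w 0 : ℂ) + (c w 2 : ℂ) * I)‖ = Real.exp (-(c w 0)) := by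
        rw [Complex.norm_exp]; simp
      have n1 : ‖(Circle.exp (c w 1) : ℂ)‖ = 1 := Circle.norm_coe _
      have hne01 : Real.exp (c w 0) ≠ 1 := by rw [Ne, Real.exp_eq_one_iff]; exact hx
      have hne21 : Real.exp (-(c w 0)) ≠ 1 := by rw [Ne, Real.exp_eq_one_iff, neg_eq_zero]; exact hx
      have hne02 : Real.exp (c w 0) ≠ Real.exp (-(c w 0)) := by
        rw [Ne, Real.exp_eq_exp]; intro h; exact hx (by linarith)
      refine injective_vec3 (fun h => hne01 ?_) (fun h => hne02 ?_) (fun h => hne21 ?_)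
      · rw [← n0, h, n1]
      · rw [← n0, h, n2]
      · rw [← n2, ← h, n1]
    · rw [if_neg hw]
      exact hc w hw

end Regular

end Literature.NumberTheory.Automorphic.UnitaryGroup

end
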